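import Summits.Ventures.WeilGRH.DualTrigKernelFamily
import HarnessLib

/-!
# Format D-K, sharper tail: the incommensurable window terms bounded by `√(A² + B²)` instead of `|A| + |B|`

Cell `rh-explicit`, WEIL TRACK — GRH ARM, route B (weil-grh-3).  In `DKCert.check` the tail inequality
(`tailOK`) bounds each incommensurable window term `A cos(κθ) + B sin(κθ)` by `|A| + |B|` (`bInc`); for a
COMPLEX value `χ(n)` the true amplitude `√(A² + B²)` is up to `√2` smaller, which at `N = 7` (primes 3, 5, 7
incommensurable, `Σ α_n = 4.18`) costs a factor `≈ 3` in the covered range `L` (the tail closes where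
`Re ψ(σ' + iL/2) ≥ B_inc − (log q − log π) − mT`).

This file adds the variant `DKCert.check2 = frameOK2 && cellsOK` whose only difference is the tail bound
`bInc2 = Σ (⌊√(Ahi² + Bhi²)⌋ + 1)` (scaled; `Nat.sqrt`, kernel-evaluable), with the same conclusions:

* `DKCert.Pθ_nonneg_of_check2`, `DKCert.sound_family2`, `DKCert.weilPositivityOnChar_family_of_check2`;
* a FRAME DECOMPOSITION for kernel-sized declarations: `frameRestOK` (constants, window data, block shape,
  atoms), the phase tables per block through the range-splittable `tabRangeT` (a function of `S`, `Kser`,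
  `kexp`, `piI`, `Mc` and the table only, so standard tables are checked once), and the tail; assembly lemmas
  `frameOK_of_parts`, `frameOK2_of_parts`, `check_of_parts`, `check2_of_parts`.

The cell checks (`cellsOK`, `blockRangeOK`) are literally the same, so instance files prove the same
cell-range declarations and only the frame theorem changes (`frameOK2`).  Everything here is PROVED; no
named facts, no `sorry`, no kernel evaluation.
-/

noncomputable section

open Finset Real Complex

namespace Summit.Ventures.WeilGRH

open Literature.Analysis.ValidatedNumerics.NumericsMP
open Literature.NumberTheory.LFunctions
open DualTrigTaylor DigammaVertical

namespace DKCert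

/-! ### The sharper tail data (computable) -/

/-- Scaled upper bound of the amplitude `√(A² + B²)` of a term: `⌊√(Ahi² + Bhi²)⌋ + 1` with
`Ahi = absHi A`, `Bhi = absHi B` (scaled by `S`). [folklore] -/
def termAmp (t : GTerm) : ℤ := (Nat.sqrt (t.A.absHi.natAbs ^ 2 + t.B.absHi.natAbs ^ 2) : ℤ) + 1

/-- `Σ termAmp` (scaled) over the incommensurable window terms. [folklore] -/
def bInc2 (c : DKCert) : ℤ := ((c.terms.filter fun t => !t.comm).map termAmp).sum

/-- The tail check with the sharper bound: at both ends of the covered range,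
`Re ψ(σ'+iỹ) + (log q − log π) − B_inc2 + mT ≥ 0`. [folklore] -/
def tailOK2 (c : DKCert) : Bool :=
  match c.blocks.head?, c.blocks.getLast? with
  | some b0, some bl =>
    let ok (Mc : ℕ) (jj : ℤ) : Bool :=
      match c.psiTailLo Mc jj with
      | some v => decide (0 ≤ v + c.constI.lo - c.bInc2 + c.mT)
      | none => false
    ok bl.Mc (bl.j0 + bl.n) && (c.even || ok b0.Mc b0.j0)
  | _, _ => false

/-- The frame checks with the sharper tail. [folklore] -/
def frameOK2 (c : DKCert) : Bool :=
  c.constsOK && c.valsOK && c.valsNodup && c.blocksOK && c.atomsOK && c.tailOK2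

/-- The complete check with the sharper tail (cells unchanged). [folklore] -/
def check2 (c : DKCert) : Bool := c.frameOK2 && c.cellsOK

variable {c : DKCert}

/-! ### Soundness of the amplitude bound -/

/-- `|A cos x + B sin x| ≤ √(A² + B²)`. [folklore] -/
theorem abs_lincomb_cos_sin_le (A B x : ℝ) :
    |A * Real.cos x + B * Real.sin x| ≤ Real.sqrt (A ^ 2 + B ^ 2) := by
  apply Real.abs_le_sqrt
  have h1 : Real.cos x ^ 2 + Real.sin x ^ 2 = 1 := Real.cos_sq_add_sin_sq x
  nlinarith [sq_nonneg (A * Real.sin x - B * Real.cos x), sq_nonneg (Real.cos x), sq_nonneg (Real.sin x)]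

/-- The value of a represented term is bounded by `termAmp / S`. [folklore] -/
theorem abs_val_le_termAmp (hS : 0 < c.S) {t : GTerm} {rt : RTerm} (h : GRepr c.S c.R t rt) (θ : ℝ) :
    |rt.val θ| ≤ (termAmp t : ℝ) / c.S := by
  have hSr : (0 : ℝ) < c.S := by exact_mod_cast hS
  have hA := abs_le_absUp hS h.memA      -- |rt.A| ≤ Ahi / S
  have hB := abs_le_absUp hS h.memB
  have hA0 : (0 : ℝ) ≤ (t.A.absHi : ℝ) / c.S := (abs_nonneg _).trans hA
  have hB0 : (0 : ℝ) ≤ (t.B.absHi : ℝ) / c.S := (abs_nonneg _).trans hB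
  -- |val| ≤ √(A² + B²) ≤ √((Ahi/S)² + (Bhi/S)²)
  have h1 : |rt.val θ| ≤ Real.sqrt (rt.A ^ 2 + rt.B ^ 2) := by
    simp only [RTerm.val]; exact abs_lincomb_cos_sin_le _ _ _
  have h2 : Real.sqrt (rt.A ^ 2 + rt.B ^ 2) ≤ Real.sqrt (((t.A.absHi : ℝ) / c.S) ^ 2 + ((t.B.absHi : ℝ) / c.S) ^ 2) := by
    apply Real.sqrt_le_sqrt
    have ha : rt.A ^ 2 ≤ ((t.A.absHi : ℝ) / c.S) ^ 2 := by
      rw [← sq_abs rt.A]; exact pow_le_pow_left₀ (abs_nonneg _) hA 2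
    have hb : rt.B ^ 2 ≤ ((t.B.absHi : ℝ) / c.S) ^ 2 := by
      rw [← sq_abs rt.B]; exact pow_le_pow_left₀ (abs_nonneg _) hB 2
    linarith
  -- √((Ahi/S)² + (Bhi/S)²) = √(Ahi² + Bhi²) / S ≤ (Nat.sqrt(..) + 1) / S
  set n : ℕ := t.A.absHi.natAbs ^ 2 + t.B.absHi.natAbs ^ 2 with hn
  have hsq : ((t.A.absHi : ℝ)) ^ 2 + ((t.B.absHi : ℝ)) ^ 2 = (n : ℝ) := by
    have e1 : ((t.A.absHi.natAbs : ℕ) : ℝ) ^ 2 = (t.A.absHi : ℝ) ^ 2 := by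
      rw [← Int.cast_natCast, Int.natCast_natAbs, Int.cast_abs, sq_abs]
    have e2 : ((t.B.absHi.natAbs : ℕ) : ℝ) ^ 2 = (t.B.absHi : ℝ) ^ 2 := by
      rw [← Int.cast_natCast, Int.natCast_natAbs, Int.cast_abs, sq_abs]
    rw [hn]; push_cast
    linarith [e1, e2]
  have h3 : Real.sqrt (((t.A.absHi : ℝ) / c.S) ^ 2 + ((t.B.absHi : ℝ) / c.S) ^ 2) = Real.sqrt (n : ℝ) / c.S := by
    rw [div_pow, div_pow, ← add_div, Real.sqrt_div' _ (by positivity), Real.sqrt_sq hSr.le, hsq]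
  have h4 : Real.sqrt (n : ℝ) ≤ (Nat.sqrt n : ℝ) + 1 := by
    have hlt : (n : ℝ) < ((Nat.sqrt n : ℝ) + 1) ^ 2 := by exact_mod_cast Nat.lt_succ_sqrt' n
    have h0 : (0 : ℝ) ≤ (Nat.sqrt n : ℝ) + 1 := by positivity
    exact (Real.sqrt_le_left h0).2 hlt.le
  have h5 : (termAmp t : ℝ) = (Nat.sqrt n : ℝ) + 1 := by
    simp only [termAmp, hn]; push_cast; ring
  calc |rt.val θ| ≤ Real.sqrt (n : ℝ) / c.S := by rw [← h3]; exact h1.trans h2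
    _ ≤ (termAmp t : ℝ) / c.S := by rw [h5]; gcongr

/-- The non-periodic terms are bounded below by `−bInc2 / S` (sharper crude bound). [folklore] -/
theorem ncList_amp_le (hS : 0 < c.S) : ∀ (ts : List GTerm) (rts : List RTerm), List.Forall₂ (GRepr c.S c.R) ts rts →
    ∀ θ : ℝ, -(((((ts.filter fun t ↦ !t.comm).map termAmp).sum : ℤ) : ℝ) / c.S) ≤ sumVal (ncList ts rts) θ
  | _, _, List.Forall₂.nil, θ => by simp [ncList]
  | _, _, @List.Forall₂.cons _ _ _ t rt ts rts hh hF, θ => by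
      have ih := ncList_amp_le hS ts rts hF θ
      by_cases hc : t.comm = true
      · simp only [ncList, hc, if_true, List.filter_cons, Bool.not_true, Bool.false_eq_true]
        exact ih
      · have hcf : t.comm = false := Bool.eq_false_iff.2 hc
        simp only [ncList, hcf, Bool.false_eq_true, if_false, sumVal_cons, List.map_cons, List.sum_cons,
          List.filter_cons, Bool.not_false, if_true] at ih ⊢
        have h1 := abs_val_le_termAmp hS hh θ
        rw [abs_le] at h1
        rw [Int.cast_add, add_div]
        linarith [h1.1]

/-! ### The certificate function is nonnegative (sharper tail) -/

/-- **The certificate function is `≥ 0` everywhere, from `check2`.**  Steps (1)–(3) of `DKCert.sound` with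
the tail inequality of `tailOK2`. [folklore] -/
theorem Pθ_nonneg_of_check2 (hc : c.check2 = true) (θ : ℝ) : 0 ≤ c.Pθ θ := by
  -- unpack the check
  unfold check2 frameOK2 at hc
  simp only [Bool.and_eq_true] at hc
  obtain ⟨⟨⟨⟨⟨⟨hconsts, hvals⟩, hnodup⟩, hblocks⟩, hatoms⟩, htail⟩, hcells⟩ := hc
  obtain ⟨hS, hp0, hD, _, hR, _, hpi, hlog, hrho, hC⟩ := constsOK_sound hconsts
  obtain ⟨hρ, hρω⟩ := rhoR_pos_and_mul hp0 hD
  have hF := terms_repr hS hpi hlog hp0 hvals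
  have hSr : (0 : ℝ) < c.S := by exact_mod_cast hS
  obtain ⟨hbs, hchain, b0, bl, h0, hl, hfirst, hlast⟩ := blocksOK_sound hblocks
  have hb0 : b0 ∈ c.blocks := List.mem_of_mem_head? h0
  have hbl : bl ∈ c.blocks := List.mem_of_mem_getLast? hl
  have hMc0 : (0 : ℝ) < b0.Mc := by exact_mod_cast (hbs b0 hb0).1
  have hMcl : (0 : ℝ) < bl.Mc := by exact_mod_cast (hbs bl hbl).1
  have hend : π ≤ bEnd bl := by
    unfold bEnd; rw [le_div_iff₀ hMcl]
    have : (bl.Mc : ℝ) ≤ 2 * ((bl.j0 : ℝ) + bl.n) := by exact_mod_cast hlast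
    nlinarith [Real.pi_pos]
  have hstart0 : bStart b0 ≤ 0 := by
    unfold bStart
    have : (b0.j0 : ℝ) ≤ 0 := by
      split_ifs at hfirst with he
      · exact_mod_cast hfirst
      · have : (2 * b0.j0 : ℝ) ≤ -(b0.Mc : ℝ) := by exact_mod_cast hfirst
        linarith
    have : 2 * π * (b0.j0 : ℝ) ≤ 0 := by nlinarith [Real.pi_pos]
    exact div_nonpos_of_nonpos_of_nonneg this hMc0.le
  -- (1) the periodic part everywhere
  have hint : ∀ rt ∈ cList c.terms c.termsR, ∃ k : ℤ, rt.κ = k :=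
    cList_int c.terms c.termsR hF isInt_of_comm
  have hT : ∀ θ : ℝ, (c.mT : ℝ) / c.S ≤ sumVal (cList c.terms c.termsR) θ := by
    intro θ
    set k : ℤ := ⌊(θ + π) / (2 * π)⌋ with hk
    set θ' : ℝ := θ - k * (2 * π) with hθ'
    have h2π : (0 : ℝ) < 2 * π := by positivity
    have hθ'1 : -π ≤ θ' := by
      have := Int.floor_le ((θ + π) / (2 * π))
      rw [← hk, le_div_iff₀ h2π] at this; rw [hθ']; linarith
    have hθ'2 : θ' ≤ π := by
      have := Int.lt_floor_add_one ((θ + π) / (2 * π))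
      rw [← hk, div_lt_iff₀ h2π] at this; rw [hθ']; linarith
    have hper : sumVal (cList c.terms c.termsR) θ = sumVal (cList c.terms c.termsR) θ' := by
      rw [hθ', show θ - k * (2 * π) = θ + (-k : ℤ) * (2 * π) by push_cast; ring]
      exact (sumVal_add_int_mul _ hint θ (-k)).symm
    rw [hper]
    by_cases he : c.even = true
    · have hevenB : ∀ t ∈ cList c.terms c.termsR, t.B = 0 :=
        fun t ht ↦ termsR_B_zero hvals he t (mem_of_mem_cList _ _ t ht)
      rcases le_total 0 θ' with hpos | hneg
      · exact T_ge_of_covered hS hpi hrho hρ hC hR hF hblocks hcells h0 hl (hstart0.trans hpos)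
          (hθ'2.trans hend) hθ'1 hθ'2
      · rw [← sumVal_neg _ hevenB θ']
        exact T_ge_of_covered hS hpi hrho hρ hC hR hF hblocks hcells h0 hl (by linarith) (by linarith)
          (by linarith) (by linarith)
    · have hstartπ : bStart b0 ≤ -π := by
        rw [Bool.not_eq_true] at he; simp only [he] at hfirst
        unfold bStart; rw [div_le_iff₀ hMc0]
        have : (2 * b0.j0 : ℝ) ≤ -(b0.Mc : ℝ) := by exact_mod_cast hfirst
        nlinarith [Real.pi_pos]
      exact T_ge_of_covered hS hpi hrho hρ hC hR hF hblocks hcells h0 hl (hstartπ.trans hθ'1)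
        (hθ'2.trans hend) hθ'1 hθ'2
  -- (2) the tail, with the sharper bound
  have hnc : ∀ θ : ℝ, -(((c.bInc2 : ℤ) : ℝ) / c.S) ≤ sumVal (ncList c.terms c.termsR) θ := by
    intro θ
    unfold bInc2
    exact ncList_amp_le hS c.terms c.termsR hF θ
  unfold tailOK2 at htail
  simp only [h0, hl, Bool.and_eq_true, Bool.or_eq_true] at htail
  obtain ⟨htl, htf⟩ := htail
  have tail_of : ∀ (Mc : ℕ) (jj : ℤ), 1 ≤ Mc →
      (match c.psiTailLo Mc jj with | some v => decide (0 ≤ v + c.constI.lo - c.bInc2 + c.mT) | none => false) = true →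
      ∀ θ : ℝ, 2 * π * |(jj : ℝ)| / Mc ≤ |θ| → 0 ≤ c.Pθ θ := by
    intro Mc jj hMc h θ hθ
    cases hv : c.psiTailLo Mc jj with
    | none => simp [hv] at h
    | some v =>
      simp only [hv, decide_eq_true_eq] at h
      have hψ := psiTailLo_sound hS hpi hrho hρ hMc jj hv hθ
      have hCr : ((c.constI.lo : ℤ) : ℝ) / c.S ≤ c.constR := lo_le hS hC
      have hsplit : sumVal c.termsR θ = sumVal (cList c.terms c.termsR) θ + sumVal (ncList c.terms c.termsR) θ := by
        rw [sumVal_cList c.terms c.termsR hF θ]; ring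
      have hz : (0 : ℝ) ≤ ((v + c.constI.lo - c.bInc2 + c.mT : ℤ) : ℝ) / c.S := by
        have : (0 : ℝ) ≤ ((v + c.constI.lo - c.bInc2 + c.mT : ℤ) : ℝ) := by exact_mod_cast h
        positivity
      unfold Pθ; rw [hsplit]
      push_cast at hz
      have := hT θ; have := hnc θ
      rw [add_div, sub_div, add_div] at hz
      linarith
  -- (3) every θ: first for θ ≥ bStart b0
  have hge : ∀ θ : ℝ, bStart b0 ≤ θ → 0 ≤ c.Pθ θ := by
    intro θ hθ
    rcases le_total θ (bEnd bl) with hle | hgt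
    · exact Pθ_nonneg_of_covered hS hpi hrho hρ hC hR hF hblocks hcells h0 hl hθ hle
    · refine tail_of bl.Mc (bl.j0 + bl.n) (hbs bl hbl).1 htl θ ?_
      have hjj : (0 : ℝ) ≤ ((bl.j0 + bl.n : ℤ) : ℝ) := by
        have : 0 < bEnd bl := lt_of_lt_of_le Real.pi_pos hend
        unfold bEnd at this
        have := (div_pos_iff_of_pos_right hMcl).1 this
        push_cast; nlinarith [Real.pi_pos]
      rw [abs_of_nonneg hjj]
      have : bEnd bl = 2 * π * ((bl.j0 + bl.n : ℤ) : ℝ) / bl.Mc := by unfold bEnd; push_cast; ring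
      rw [← this]
      exact hgt.trans (le_abs_self θ)
  rcases le_total (bStart b0) θ with hθ | hθ
  · exact hge θ hθ
  · by_cases he : c.even = true
    · rw [← Pθ_neg hvals he θ]
      exact hge (-θ) (by linarith)
    · rw [Bool.not_eq_true] at he
      simp only [he, Bool.false_eq_true, false_or] at htf
      refine tail_of b0.Mc b0.j0 (hbs b0 hb0).1 htf θ ?_
      simp only [he, Bool.false_eq_true, if_false] at hfirst
      have hj0 : (b0.j0 : ℝ) ≤ 0 := by
        have : (2 * b0.j0 : ℝ) ≤ -(b0.Mc : ℝ) := by exact_mod_cast hfirst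
        linarith
      rw [abs_of_nonpos hj0]
      have hθ0 : θ ≤ 0 := hθ.trans hstart0
      rw [abs_of_nonpos hθ0]
      unfold bStart at hθ
      have : 2 * π * -(b0.j0 : ℝ) / b0.Mc = -(2 * π * b0.j0 / b0.Mc) := by ring
      rw [this]; linarith

/-! ### The family theorems from `check2` -/

/-- **Soundness for the whole key group, every modulus `q ≥ c.q`, from `check2`.** [folklore] -/
theorem sound_family2 (hc : c.check2 = true) {q : ℕ} (hq : c.q ≤ q) (χ : DirichletCharacter ℂ q)
    (hpar : charParity χ = c.par) (hχ : ∀ val ∈ c.vals, χ (val.n : ZMod q) = valZ val)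
    (hχ0 : ∀ n : ℕ, n ≤ c.N → IsPrimePow n → ¬ Nat.Coprime n c.q → χ (n : ZMod q) = 0) (τ : ℝ) :
    0 ≤ weilFinitePrimeWeightChar χ c.N τ + trigSum (c.atoms.map c.atomT) τ := by
  have hmain := Pθ_nonneg_of_check2 hc (c.omegaR * τ)
  unfold check2 frameOK2 at hc
  simp only [Bool.and_eq_true] at hc
  obtain ⟨⟨⟨⟨⟨⟨hconsts, hvals⟩, hnodup⟩, _⟩, _⟩, _⟩, _⟩ := hc
  obtain ⟨_, hp0, hD, _, _, _, _, _, _, _⟩ := constsOK_sound hconsts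
  obtain ⟨_, hρω⟩ := rhoR_pos_and_mul hp0 hD
  unfold Pθ at hmain
  have hval := sumVal_valsR_eq_family (χ := χ) hp0 hD hvals (by
    unfold valsNodup at hnodup; simpa using hnodup) hχ hχ0 τ
  unfold termsR at hmain
  rw [sumVal_append, sumVal_atoms, hval] at hmain
  unfold weilFinitePrimeWeightChar
  have harg : (c.sigR : ℂ) + ((c.rhoR * (c.omegaR * τ) : ℝ) : ℂ) * I =
      1 / 4 + (charParity χ : ℂ) / 2 + (τ : ℂ) / 2 * I := by
    rw [← mul_assoc, hρω, hpar]
    unfold sigR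
    push_cast; ring
  rw [harg] at hmain
  unfold constR at hmain
  have hlog := log_threshold_le (c := c) hq
  linarith

/-- **The rung for the whole key group, every modulus `q ≥ c.q`, from `check2`** (same statement as
`weilPositivityOnChar_family_of_check`; only the certified tail inequality differs). [folklore] -/
theorem weilPositivityOnChar_family_of_check2 (hc : c.check2 = true) {q : ℕ} (hq : c.q ≤ q) (hq1 : q ≠ 1)
    (χ : DirichletCharacter ℂ q) (hpar : charParity χ = c.par)
    (hχ : ∀ val ∈ c.vals, χ (val.n : ZMod q) = valZ val)
    (hχ0 : ∀ n : ℕ, n ≤ c.N → IsPrimePow n → ¬ Nat.Coprime n c.q → χ (n : ZMod q) = 0) :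
    WeilPositivityOnChar χ (Real.log ((c.N : ℝ) + 1) / 2) := by
  refine weilPositivityOnChar_of_trigDual hq1 χ c.N (c.atoms.map c.atomT) ?_ (sound_family2 hc hq χ hpar hχ hχ0)
  have hc' := hc
  unfold check2 frameOK2 at hc'
  simp only [Bool.and_eq_true] at hc'
  obtain ⟨⟨⟨⟨⟨⟨hconsts, _⟩, _⟩, _⟩, hatoms⟩, _⟩, _⟩ := hc'
  obtain ⟨_, hp0, hD, -⟩ := constsOK_sound hconsts
  intro A hA
  rw [List.mem_map] at hA
  obtain ⟨atm, hatm, rfl⟩ := hA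
  unfold atomsOK at hatoms
  rw [List.all_eq_true] at hatoms
  have h := hatoms atm hatm
  rw [decide_eq_true_eq] at h
  simp only [atomT, omegaR]
  have hp0r : (1 : ℝ) < c.p0 := by exact_mod_cast hp0
  have hDr : (0 : ℝ) < c.D := by exact_mod_cast hD
  have hN1 : (0 : ℝ) < (c.N : ℝ) + 1 := by positivity
  have hreal : ((c.N : ℝ) + 1) ^ c.D ≤ (c.p0 : ℝ) ^ atm.k := by exact_mod_cast h
  have hlogle := Real.log_le_log (by positivity) hreal
  rw [Real.log_pow, Real.log_pow] at hlogle
  rw [← mul_div_assoc, le_div_iff₀ hDr]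
  linarith

end DKCert

end Summit.Ventures.WeilGRH

end
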